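import Literature.Computability.Complexity.LundYannakakis
import Literature.Computability.Complexity.FoldBricks
import Literature.Computability.Complexity.ListFoldBricks
import Literature.Computability.Complexity.StackBricksStrings
import Literature.Computability.Complexity.StackWordArith
import HarnessLib

/-!
# The Lund–Yannakakis reduction, Ib: the instance map is polynomial time (`lyMap_mem_FP_holds`)

Topic `Computability/Complexity`, namespace `Literature.Computability.Complexity` (bricks in the
sub-namespace `LYFP`). Companion of `LundYannakakis.lean`, which constructs the set cover instance
`lyReduce φ` of a label cover instance `φ` (Arora–Barak 2009, proof of Thm. 22.31, with the
hypercube set gadget) and the patched instance map `lyMap W`, and vendors the implementation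
statement `lyMap_mem_FP` ("there is a polynomial-time transformation `f` from `2CSP_W` instances to
instances of SET-COVER") as a named fact. This file DISCHARGES it: `lyMap_mem_FP_holds`.

No machine is written. The string function `LYFP.lyF W` computing `code φ ↦ code (lyMap W φ)` is
assembled in the `FP` brick algebra of the tree (`BrickAlgebra.lean`, `FoldBricks.lean`,
`ListFoldBricks.lean`, `HashBricks.lean`, `StackBricksArith.lean`), in the style of
`SharpSATNormalFormFP.lean`:

* the guard `[W' = W] ∧ ¬[2m < n]` (`LYFP.guardP`: `Brick.eqValFn`, `Brick.ltFn` on the binary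
  length `Brick.lenBinF` of the unary constraint header) selects (`iteFn`) between the constant code
  of `⟨0, [], 0⟩` and the main branch;
* the main branch writes `⟨⌜m · 2^W⌝, ⟨⟨1^{nW}, frames of the set codes⟩, ⌜n⌝⟩⟩`
  (`LYFP.mainP`; `Brick.prodFn`, `Brick.onesMulFn`, `binToUnaryFn`);
* the set codes are produced by a counted fold `Brick.foldLoop appF (clipF …)` over the set index
  `p < nW` (`LYFP.runP`; yardstick `x = ⟨w, 1^{(|w|+1)²}⟩`), whose piece `LYFP.pieceP` is the framed
  code `⟨1^{|S_p|}, frames (S_p)⟩` of `S_p = S_{p / W, p % W}`, itself produced by two counted folds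
  over the element index `e < m · 2^W` (`LYFP.runE`): one concatenating a `1` per member (the unary
  length header), the other the framed numerals `⌜e⌝` of the members (`LYFP.pieceE`);
* the membership test `LYFP.testV` of `e = 2^W r + b` in `S_{i,u}` reads `i = p / W`, `u = p % W`,
  `r`, `b` with `Brick.divFn`/`Brick.remFn`, the constraint `φ_r` with `HashBricks.nthItemFn`, its
  fields with `Brick.nthF`, the value `h_r(u)` with `nthItemFn` again, and the bits `b_u`,
  `b_{h_r(u)}` with `bitAtFn`/`HashBricks.headBitFn`; it is the Boolean `lyRow φ_r i u b` of
  `LundYannakakis.lean` (`LYFP.testV_eq`).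

Correctness (`LYFP.lyF_encode`) is by the closed-form values of the bricks (`foldLoop_apply`,
`foldAcc_clipF`, `foldAcc_appF`) and two bookkeeping identities between concatenations of indexed
pieces (`ccat`) and framed codes of ranges / filtered ranges (`LYFP.frames_map_range`,
`LYFP.frames_map_filter_range`); membership in `FP` (`LYFP.lyF_mem_FP`) is by composition alone
(the clipped folds are in `FP` unconditionally, `foldLoop_clipF_mem_FP`), the clipping being
harmless on the pieces actually folded (`LYFP.length_pieceE_le_clip`, `LYFP.length_pieceP_le_clip`).

## References

* S. Arora, B. Barak, *Computational Complexity: A Modern Approach*, CUP 2009, §22.8, Thm. 22.31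
  and its proof (book pp. 486–487: "there is a polynomial-time transformation f from `2CSP_W`
  instances to instances of SET-COVER"; "The ground set is `[m] × B` … for each variable `i ∈ [n]`
  and value `u ∈ [W]` there is a subset `S_{i,u}` which is the union of `{r} × C_u` for each
  `r ∈ Δ_i` and `{r} × B ∖ C_{h(u)}` for each `r ∈ Γ_i`"), §1.3 (polynomial time is closed under
  composition and polynomially bounded loops), §0.1 (codes of tuples and lists).
* C. Lund, M. Yannakakis, *On the hardness of approximating minimization problems*, J. ACM 41
  (1994) 960–981, §3.
-/

namespace Literature.Computability.Complexity

open _root_.Computability Brick HashBricks Plumb OracleCompose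

namespace LYFP

/-! ### Bookkeeping: framed codes, concatenations of indexed pieces -/

/-- The framed code is the nested-pair body (`OracleCompose.body`). [folklore] -/
theorem frames_eq_body : ∀ l : List (List Bool), frames l = body l
  | [] => rfl
  | a :: l => by rw [frames_cons_eq_boolPair, body_cons, frames_eq_body l]

/-- The framed code of a map over a range is a concatenation of indexed frames. [folklore] -/
theorem frames_map_range (g : ℕ → List Bool) : ∀ k : ℕ,
    frames ((List.range k).map g) = ccat (fun p => boolPair (g p) []) k
  | 0 => rfl
  | k + 1 => by
    rw [List.range_succ, List.map_append, frames_append, frames_map_range g k, ccat_succ,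
      List.map_singleton, frames_cons_eq_boolPair, frames_nil]

/-- The framed code of a map over a filtered range is a concatenation of indexed optional frames.
[folklore] -/
theorem frames_map_filter_range (g : ℕ → List Bool) (P : ℕ → Bool) : ∀ k : ℕ,
    frames (((List.range k).filter P).map g) = ccat (fun e => if P e then boolPair (g e) [] else []) k
  | 0 => rfl
  | k + 1 => by
    rw [List.range_succ, List.filter_append, List.map_append, frames_append,
      frames_map_filter_range g P k, ccat_succ, List.filter_singleton]
    cases P k <;> simp [boolPair_eq]

/-- A `1` per selected index concatenates to the unary count. [folklore] -/
theorem ccat_ite_true (P : ℕ → Bool) : ∀ k : ℕ,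
    ccat (fun e => if P e then [true] else []) k = ones ((List.range k).filter P).length
  | 0 => rfl
  | k + 1 => by
    rw [ccat_succ, ccat_ite_true P k, List.range_succ, List.filter_append, List.filter_singleton,
      List.length_append]
    cases P k <;> simp [List.replicate_add]

/-- Length of a concatenation whose pieces below `n` are bounded. [folklore] -/
theorem length_ccat_le_of_lt (g : ℕ → List Bool) (b : ℕ) :
    ∀ n, (∀ i, i < n → (g i).length ≤ b) → (ccat g n).length ≤ n * b
  | 0, _ => by simp
  | n + 1, h => by
    rw [ccat_succ, List.length_append, Nat.succ_mul]
    exact Nat.add_le_add (length_ccat_le_of_lt g b n fun i hi => h i (by omega)) (h n (by omega))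

/-- Reading one symbol at a position: `((l ⇂ k) ↾ 1).headD 0 = l[k] (default 0)`. [folklore] -/
theorem headD_take_one_drop (l : List Bool) (k : ℕ) :
    ((l.drop k).take 1).headD false = l.getD k false := by
  rw [List.getD_eq_getElem?_getD, ← List.head?_drop]
  cases l.drop k <;> rfl

/-- The bits of a numeral: `⌜b⌝[t] (default 0) = testBit b t` (private copy of
`TripleDecoder.getD_encodeNat_eq_testBit`, `Barriers/PneNP/FeasibleInterpolationProofs.lean`, a leaf file
not importable into the toolkit). [folklore] -/
private theorem getD_encodeNat (b t : ℕ) : (encodeNat b).getD t false = b.testBit t := by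
  rw [← Com.testBit_bitsToNat, bitsToNat_encodeNat]

/-- A bit position may be capped at any bound on the bit length. [folklore] -/
theorem testBit_min_of_lt {b W : ℕ} (hb : b < 2 ^ W) (h : ℕ) :
    b.testBit (min h W) = b.testBit h := by
  rcases le_or_gt h W with hle | hlt
  · rw [min_eq_left hle]
  · rw [min_eq_right hlt.le, Nat.testBit_lt_two_pow hb,
      Nat.testBit_lt_two_pow (hb.trans_le (Nat.pow_le_pow_right (by norm_num) hlt.le))]

/-- `|⌜n⌝| ≤ n + 1`, hence `2|⌜e⌝| + 2 ≤ 2K + 4` for `e < K`. [folklore] -/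
theorem two_mul_length_encodeNat_le {e K : ℕ} (h : e < K) : 2 * (encodeNat e).length + 2 ≤ 2 * K + 4 := by
  have := TM2Pass.length_encodeNat_le_self e; omega

/-! ### The codes of instances, unfolded -/

/-- The code of one projection constraint `(i, j, h)` inside the instance code:
`⟨⌜i⌝, ⟨⌜j⌝, ⟨1^{|h|}, body [⌜h 0⌝, …]⟩⟩⟩`.
[cite: AroraBarak2009, §0.1 (codes of tuples and lists)] -/
def ccode (K : LabelCoverConstraint) : List Bool :=
  boolPair (encodeNat K.fst) (boolPair (encodeNat K.snd)
    (boolPair (ones K.proj.length) (body (K.proj.map encodeNat))))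

/-- **The code of a label cover instance, unfolded**: `⟨⌜n⌝, ⟨⌜W⌝, ⟨1ᵐ, body [ccode φ_r]_r⟩⟩⟩`.
[cite: AroraBarak2009, §0.1 (codes of tuples and lists)] -/
theorem encode_labelCover (φ : LabelCoverInstance) :
    LabelCoverInstance.encoding.encode φ =
      boolPair (encodeNat φ.numVars) (boolPair (encodeNat φ.alphabetSize)
        (boolPair (ones φ.numConstraints) (body (φ.constraints.map ccode)))) := by
  rw [LabelCoverInstance.encoding_encode]
  simp only [LabelCoverInstance.tupleEncoding, LabelCoverInstance.toTuple, Encoding.pairBool,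
    Encoding.listBool, foldr_boolPair_eq, frames_eq_body, List.map_map, List.length_map,
    unaryEncodeNat_eq_replicate, LabelCoverInstance.numConstraints, encodingNatBool,
    Function.comp_def]
  rfl

/-- The `listBool` code of a list of naturals: `⟨1^{|S|}, frames [⌜e⌝]_{e ∈ S}⟩`.
[cite: AroraBarak2009, §0.1 (codes of tuples and lists)] -/
def setCode (S : List ℕ) : List Bool :=
  boolPair (ones S.length) (frames (S.map encodeNat))

/-- `encodingNatBool.listBool` writes `setCode`. [folklore] -/
theorem listBool_encode_nat (S : List ℕ) : encodingNatBool.listBool.encode S = setCode S := by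
  simp only [Encoding.listBool, foldr_boolPair_eq, unaryEncodeNat_eq_replicate, setCode]
  rfl

/-- **The code of a set cover instance, unfolded**:
`⟨⌜|U|⌝, ⟨⟨1^{#sets}, frames [setCode S_j]_j⟩, ⌜K⌝⟩⟩`.
[cite: AroraBarak2009, §0.1 (codes of tuples and lists)] -/
theorem encode_setCover (I : SetCoverInstance) :
    SetCoverInstance.encoding.encode I =
      boolPair (encodeNat I.univSize) (boolPair
        (boolPair (ones I.sets.length) (frames (I.sets.map setCode))) (encodeNat I.K)) := by
  rw [SetCoverInstance.encoding_encode]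
  simp only [SetCoverInstance.tupleEncoding, SetCoverInstance.toTuple, Encoding.pairBool]
  congr 2
  simp only [Encoding.listBool, foldr_boolPair_eq, unaryEncodeNat_eq_replicate]
  rfl


/-! ### Fields of the instance code -/

/-- Field `0` of the instance code: `⌜n⌝`. [folklore] -/
@[simp] theorem fstF_encode (φ : LabelCoverInstance) :
    fstF (LabelCoverInstance.encoding.encode φ) = encodeNat φ.numVars := by
  rw [encode_labelCover]; simp

/-- Field `0` of the instance code: `⌜n⌝` (as `nthF 0`). [folklore] -/
theorem nthF_zero_encode (φ : LabelCoverInstance) :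
    nthF 0 (LabelCoverInstance.encoding.encode φ) = encodeNat φ.numVars := by
  rw [nthF_zero, fstF_encode]

/-- Field `1` of the instance code: `⌜W⌝`. [folklore] -/
@[simp] theorem nthF_one_encode (φ : LabelCoverInstance) :
    nthF 1 (LabelCoverInstance.encoding.encode φ) = encodeNat φ.alphabetSize := by
  rw [encode_labelCover]; simp

/-- Field `2` of the instance code: the unary header `1ᵐ` of the constraint list. [folklore] -/
@[simp] theorem nthF_two_encode (φ : LabelCoverInstance) :
    nthF 2 (LabelCoverInstance.encoding.encode φ) = ones φ.numConstraints := by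
  rw [encode_labelCover]; simp

/-- The tail after field `2`: the coded constraint list. [folklore] -/
@[simp] theorem sndPow_two_encode (φ : LabelCoverInstance) :
    sndPow 2 (LabelCoverInstance.encoding.encode φ) = body (φ.constraints.map ccode) := by
  rw [encode_labelCover]; simp

/-- The instance code is longer than `2m`. [folklore] -/
theorem two_mul_numConstraints_le_length_encode (φ : LabelCoverInstance) :
    2 * φ.numConstraints ≤ (LabelCoverInstance.encoding.encode φ).length := by
  rw [encode_labelCover]
  simp only [length_boolPair, List.length_replicate]
  omega

/-- Field `0` of a constraint code: `⌜i⌝`. [folklore] -/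
@[simp] theorem fstF_ccode (K : LabelCoverConstraint) : fstF (ccode K) = encodeNat K.fst := by
  simp [ccode]

/-- Field `1` of a constraint code: `⌜j⌝`. [folklore] -/
@[simp] theorem nthF_one_ccode (K : LabelCoverConstraint) : nthF 1 (ccode K) = encodeNat K.snd := by
  simp [ccode]

/-- The tail after field `2` of a constraint code: the coded projection `body [⌜h 0⌝, …]`. [folklore] -/
@[simp] theorem sndPow_two_ccode (K : LabelCoverConstraint) :
    sndPow 2 (ccode K) = body (K.proj.map encodeNat) := by
  simp [ccode]

/-- Reading a coded list of numerals with default: `[⌜h v⌝]_v [u] = ⌜h.getD u 0⌝`. [folklore] -/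
theorem getD_map_encodeNat (l : List ℕ) (u : ℕ) : (l.map encodeNat).getD u [] = encodeNat (l.getD u 0) := by
  rw [show ([] : List Bool) = encodeNat 0 from rfl, List.getD_map]

/-! ### The membership test of an element in a set `S_{i,u}` -/

/-- The argument records of the set pieces, `⟬w, R, p⟭ = ⟨⟨w, R⟩, 1ᵖ⟩` (`w` the instance code, `R` the
yardstick pad, `p = W i + u` the set index); the element pieces see `⟨⟬w, R, p⟭, 1ᵉ⟩`, `e = 2^W r + b`
the element. -/
local notation "⟬" w ", " R ", " p "⟭" => boolPair (boolPair w R) (ones p)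

/-- The instance code `w` read off the piece argument. [folklore] -/
noncomputable def wV : List Bool → List Bool := fstF ∘ fstF ∘ fstF

/-- The set index `1ᵖ` read off the piece argument. [folklore] -/
noncomputable def idxV : List Bool → List Bool := sndF ∘ fstF

/-- `wV` reads `w`. [folklore] -/
@[simp] theorem wV_apply (w R : List Bool) (p e : ℕ) : wV (boolPair ⟬w, R, p⟭ (ones e)) = w := by
  simp [wV]

/-- `idxV` reads `1ᵖ`. [folklore] -/
@[simp] theorem idxV_apply (w R : List Bool) (p e : ℕ) : idxV (boolPair ⟬w, R, p⟭ (ones e)) = ones p := by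
  simp [idxV]

/-- `wV ∈ FP`. [folklore] -/
theorem wV_mem_FP : wV ∈ FP := comp_mem_FP fstF_mem_FP (comp_mem_FP fstF_mem_FP fstF_mem_FP)

/-- `idxV ∈ FP`. [folklore] -/
theorem idxV_mem_FP : idxV ∈ FP := comp_mem_FP sndF_mem_FP fstF_mem_FP

/-- The variable `⌜i⌝ = ⌜p / W⌝` of the set `S_{i,u}`, `p = W i + u`.
[cite: AroraBarak2009, proof of Thm. 22.31 (§22.8)] -/
noncomputable def iV (W : ℕ) : List Bool → List Bool :=
  divFn ∘ fanoutFn (lenBinF ∘ idxV) (fun _ => encodeNat W)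

/-- `iV` reads `⌜p / W⌝`. [folklore] -/
@[simp] theorem iV_apply (W : ℕ) (w R : List Bool) (p e : ℕ) :
    iV W (boolPair ⟬w, R, p⟭ (ones e)) = encodeNat (p / W) := by
  simp [iV]

/-- `iV W ∈ FP`. [folklore] -/
theorem iV_mem_FP (W : ℕ) : iV W ∈ FP :=
  comp_mem_FP divFn_mem_FP (fanoutFn_mem_FP (comp_mem_FP lenBinF_mem_FP idxV_mem_FP) (const_mem_FP _))

/-- The value `1ᵘ = 1^{p % W}` of the set `S_{i,u}` (unary, capped at `W`).
[cite: AroraBarak2009, proof of Thm. 22.31 (§22.8)] -/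
noncomputable def uV (W : ℕ) : List Bool → List Bool :=
  binToUnaryFn ∘ fanoutFn (fun _ => ones W) (remFn ∘ fanoutFn (lenBinF ∘ idxV) (fun _ => encodeNat W))

/-- `uV` reads `1^{p % W}` (for `W > 0`). [folklore] -/
@[simp] theorem uV_apply {W : ℕ} (hW : 0 < W) (w R : List Bool) (p e : ℕ) :
    uV W (boolPair ⟬w, R, p⟭ (ones e)) = ones (p % W) := by
  simp [uV, min_eq_left (Nat.mod_lt p hW).le]

/-- `uV W ∈ FP`. [folklore] -/
theorem uV_mem_FP (W : ℕ) : uV W ∈ FP :=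
  comp_mem_FP binToUnaryFn_mem_FP (fanoutFn_mem_FP (const_mem_FP _)
    (comp_mem_FP remFn_mem_FP (fanoutFn_mem_FP (comp_mem_FP lenBinF_mem_FP idxV_mem_FP) (const_mem_FP _))))

/-- The row `1ʳ = 1^{e / 2^W}` of the element `e` (unary, capped at `e`).
[cite: AroraBarak2009, proof of Thm. 22.31 (§22.8)] -/
noncomputable def rV (W : ℕ) : List Bool → List Bool :=
  binToUnaryFn ∘ fanoutFn sndF (divFn ∘ fanoutFn (lenBinF ∘ sndF) (fun _ => encodeNat (2 ^ W)))

/-- `rV` reads `1^{e / 2^W}`. [folklore] -/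
@[simp] theorem rV_apply (W : ℕ) (w R : List Bool) (p e : ℕ) :
    rV W (boolPair ⟬w, R, p⟭ (ones e)) = ones (e / 2 ^ W) := by
  simp [rV, min_eq_left (Nat.div_le_self e (2 ^ W))]

/-- `rV W ∈ FP`. [folklore] -/
theorem rV_mem_FP (W : ℕ) : rV W ∈ FP :=
  comp_mem_FP binToUnaryFn_mem_FP (fanoutFn_mem_FP sndF_mem_FP
    (comp_mem_FP divFn_mem_FP (fanoutFn_mem_FP (comp_mem_FP lenBinF_mem_FP sndF_mem_FP) (const_mem_FP _))))

/-- The gadget point `⌜b⌝ = ⌜e % 2^W⌝` of the element `e` (a bit vector of `{0,1}^W` as a number).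
[cite: AroraBarak2009, proof of Thm. 22.31 (§22.8)] -/
noncomputable def bV (W : ℕ) : List Bool → List Bool :=
  remFn ∘ fanoutFn (lenBinF ∘ sndF) (fun _ => encodeNat (2 ^ W))

/-- `bV` reads `⌜e % 2^W⌝`. [folklore] -/
@[simp] theorem bV_apply (W : ℕ) (w R : List Bool) (p e : ℕ) :
    bV W (boolPair ⟬w, R, p⟭ (ones e)) = encodeNat (e % 2 ^ W) := by
  simp [bV]

/-- `bV W ∈ FP`. [folklore] -/
theorem bV_mem_FP (W : ℕ) : bV W ∈ FP :=
  comp_mem_FP remFn_mem_FP (fanoutFn_mem_FP (comp_mem_FP lenBinF_mem_FP sndF_mem_FP) (const_mem_FP _))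

/-- The code of the constraint `φ_r` of the row of `e` (item `r` of the coded constraint list).
[cite: AroraBarak2009, proof of Thm. 22.31 (§22.8)] -/
noncomputable def cV (W : ℕ) : List Bool → List Bool :=
  nthItemFn ∘ fanoutFn (rV W) (sndPow 2 ∘ wV)

/-- `cV` reads `ccode φ_r`, `r = e / 2^W < m`. [folklore] -/
theorem cV_apply (W : ℕ) (φ : LabelCoverInstance) (R : List Bool) (p : ℕ) {e : ℕ}
    (hr : e / 2 ^ W < φ.numConstraints) :
    cV W (boolPair ⟬LabelCoverInstance.encoding.encode φ, R, p⟭ (ones e)) =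
      ccode (φ.constraints[e / 2 ^ W]'hr) := by
  simp only [cV, Function.comp_apply, fanoutFn_apply, rV_apply, wV_apply, sndPow_two_encode,
    nthItemFn_body, List.getD_eq_getElem?_getD, List.getElem?_map,
    List.getElem?_eq_getElem (show e / 2 ^ W < φ.constraints.length from hr), Option.map_some,
    Option.getD_some]
  rfl

/-- `cV W ∈ FP`. [folklore] -/
theorem cV_mem_FP (W : ℕ) : cV W ∈ FP :=
  comp_mem_FP nthItemFn_mem_FP (fanoutFn_mem_FP (rV_mem_FP W) (comp_mem_FP (sndPow_mem_FP 2) wV_mem_FP))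

/-- The projected value `1^{min (h_r(u), W)}` (item `u` of the coded projection of `φ_r`, unary,
capped at `W`: a position `≥ W` reads the same bit `0` of a `W`-bit point).
[cite: AroraBarak2009, proof of Thm. 22.31 (§22.8)] -/
noncomputable def hV (W : ℕ) : List Bool → List Bool :=
  binToUnaryFn ∘ fanoutFn (fun _ => ones W) (nthItemFn ∘ fanoutFn (uV W) (sndPow 2 ∘ cV W))

/-- `hV` reads `1^{min (h_r (p % W), W)}`. [folklore] -/
theorem hV_apply {W : ℕ} (hW : 0 < W) (φ : LabelCoverInstance) (R : List Bool) (p : ℕ) {e : ℕ}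
    (hr : e / 2 ^ W < φ.numConstraints) :
    hV W (boolPair ⟬LabelCoverInstance.encoding.encode φ, R, p⟭ (ones e)) =
      ones (min ((φ.constraints[e / 2 ^ W]'hr).projAt (p % W)) W) := by
  simp only [hV, Function.comp_apply, fanoutFn_apply, uV_apply hW, cV_apply W φ R p hr, sndPow_two_ccode,
    nthItemFn_body, getD_map_encodeNat, binToUnaryFn_boolPair, bitsToNat_encodeNat, List.length_replicate]
  rfl

/-- `hV W ∈ FP`. [folklore] -/
theorem hV_mem_FP (W : ℕ) : hV W ∈ FP :=
  comp_mem_FP binToUnaryFn_mem_FP (fanoutFn_mem_FP (const_mem_FP _)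
    (comp_mem_FP nthItemFn_mem_FP
      (fanoutFn_mem_FP (uV_mem_FP W) (comp_mem_FP (sndPow_mem_FP 2) (cV_mem_FP W)))))

/-- The bit of the point `b` at the unary position computed by `pos`: `[b_{|pos|}]`.
[cite: AroraBarak2009, proof of Thm. 22.31 (§22.8, `C_u = {b | b_u = 1}`)] -/
noncomputable def bitV (W : ℕ) (pos : List Bool → List Bool) : List Bool → List Bool :=
  headBitFn ∘ bitAtFn ∘ fanoutFn pos (bV W)

/-- `bitV` reads the bit `testBit b |pos|`. [folklore] -/
theorem bitV_apply (W : ℕ) (pos : List Bool → List Bool) (w R : List Bool) (p e : ℕ) :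
    bitV W pos (boolPair ⟬w, R, p⟭ (ones e)) =
      [(e % 2 ^ W).testBit (pos (boolPair ⟬w, R, p⟭ (ones e))).length] := by
  simp only [bitV, Function.comp_apply, fanoutFn_apply, bV_apply, bitAtFn_boolPair, headBitFn_apply,
    headD_take_one_drop, getD_encodeNat]

/-- `bitV W pos` is one-bit. [folklore] -/
theorem oneBit_bitV (W : ℕ) (pos : List Bool → List Bool) : OneBit (bitV W pos) :=
  oneBit_headBitFn.comp _

/-- `bitV W pos ∈ FP` for `pos ∈ FP`. [folklore] -/
theorem bitV_mem_FP (W : ℕ) {pos : List Bool → List Bool} (hpos : pos ∈ FP) : bitV W pos ∈ FP :=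
  comp_mem_FP headBitFn_mem_FP (comp_mem_FP bitAtFn_mem_FP (fanoutFn_mem_FP hpos (bV_mem_FP W)))

/-- First disjunct of the membership test: `[j_r = i ∧ b ∈ C_u]`.
[cite: AroraBarak2009, proof of Thm. 22.31 (§22.8, "`{r} × C_u` for each `r ∈ Δ_i`")] -/
noncomputable def t1V (W : ℕ) : List Bool → List Bool :=
  andFn (eqValFn ∘ fanoutFn (nthF 1 ∘ cV W) (iV W)) (bitV W (uV W))

/-- Second disjunct of the membership test: `[i_r = i ∧ b ∉ C_{h_r(u)}]`.
[cite: AroraBarak2009, proof of Thm. 22.31 (§22.8, "`{r} × B ∖ C_{h(u)}` for each `r ∈ Γ_i`")] -/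
noncomputable def t2V (W : ℕ) : List Bool → List Bool :=
  andFn (eqValFn ∘ fanoutFn (nthF 0 ∘ cV W) (iV W)) (notFn (bitV W (hV W)))

/-- **The membership test** `[e ∈ S_{i,u}]` on `⟨⟨⟨w, R⟩, 1ᵖ⟩, 1ᵉ⟩`.
[cite: AroraBarak2009, proof of Thm. 22.31 (§22.8)] -/
noncomputable def testV (W : ℕ) : List Bool → List Bool :=
  orFn (t1V W) (t2V W)

/-- `t1V W ∈ FP`. [folklore] -/
theorem t1V_mem_FP (W : ℕ) : t1V W ∈ FP :=
  andFn_mem_FP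
    (comp_mem_FP eqValFn_mem_FP (fanoutFn_mem_FP (comp_mem_FP (nthF_mem_FP 1) (cV_mem_FP W)) (iV_mem_FP W)))
    (bitV_mem_FP W (uV_mem_FP W))

/-- `t2V W ∈ FP`. [folklore] -/
theorem t2V_mem_FP (W : ℕ) : t2V W ∈ FP :=
  andFn_mem_FP
    (comp_mem_FP eqValFn_mem_FP (fanoutFn_mem_FP (comp_mem_FP (nthF_mem_FP 0) (cV_mem_FP W)) (iV_mem_FP W)))
    (notFn_mem_FP (bitV_mem_FP W (hV_mem_FP W)))

/-- `testV W ∈ FP`. [folklore] -/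
theorem testV_mem_FP (W : ℕ) : testV W ∈ FP := orFn_mem_FP (t1V_mem_FP W) (t2V_mem_FP W)

/-- `t1V W` is one-bit. [folklore] -/
theorem oneBit_t1V (W : ℕ) : OneBit (t1V W) := oneBit_andFn (oneBit_eqValFn.comp _) (oneBit_bitV W _)

/-- `t2V W` is one-bit. [folklore] -/
theorem oneBit_t2V (W : ℕ) : OneBit (t2V W) :=
  oneBit_andFn (oneBit_eqValFn.comp _) (oneBit_notFn (oneBit_bitV W _))

/-- `testV W` is one-bit. [folklore] -/
theorem oneBit_testV (W : ℕ) : OneBit (testV W) := oneBit_orFn (oneBit_t1V W) (oneBit_t2V W)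

/-- **The membership test computes `lyRow φ_r i u b`** (`i = p / W`, `u = p % W`, `r = e / 2^W < m`,
`b = e % 2^W`). [cite: AroraBarak2009, proof of Thm. 22.31 (§22.8)] -/
theorem testV_eq {W : ℕ} (hW : 0 < W) (φ : LabelCoverInstance) (R : List Bool) (p : ℕ) {e : ℕ}
    (hr : e / 2 ^ W < φ.numConstraints) :
    testV W (boolPair ⟬LabelCoverInstance.encoding.encode φ, R, p⟭ (ones e)) =
      [(φ.constraints[e / 2 ^ W]'hr).lyRow (p / W) (p % W) (e % 2 ^ W)] := by
  set K := φ.constraints[e / 2 ^ W]'hr with hK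
  have hj : (eqValFn ∘ fanoutFn (nthF 1 ∘ cV W) (iV W))
      (boolPair ⟬LabelCoverInstance.encoding.encode φ, R, p⟭ (ones e)) = [decide (K.snd = p / W)] := by
    simp only [Function.comp_apply, fanoutFn_apply, cV_apply W φ R p hr, nthF_one_ccode, iV_apply,
      eqValFn_boolPair, bitsToNat_encodeNat, hK]
  have hi : (eqValFn ∘ fanoutFn (nthF 0 ∘ cV W) (iV W))
      (boolPair ⟬LabelCoverInstance.encoding.encode φ, R, p⟭ (ones e)) = [decide (K.fst = p / W)] := by
    simp only [Function.comp_apply, fanoutFn_apply, cV_apply W φ R p hr, nthF_zero, fstF_ccode, iV_apply,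
      eqValFn_boolPair, bitsToNat_encodeNat, hK]
  have hu : bitV W (uV W) (boolPair ⟬LabelCoverInstance.encoding.encode φ, R, p⟭ (ones e)) =
      [(e % 2 ^ W).testBit (p % W)] := by
    rw [bitV_apply, uV_apply hW, List.length_replicate]
  have hh : bitV W (hV W) (boolPair ⟬LabelCoverInstance.encoding.encode φ, R, p⟭ (ones e)) =
      [(e % 2 ^ W).testBit (K.projAt (p % W))] := by
    rw [bitV_apply, hV_apply hW φ R p hr, List.length_replicate,
      testBit_min_of_lt (Nat.mod_lt e (Nat.two_pow_pos W))]
  have h1 : t1V W (boolPair ⟬LabelCoverInstance.encoding.encode φ, R, p⟭ (ones e)) =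
      [decide (K.snd = p / W) && (e % 2 ^ W).testBit (p % W)] := andFn_apply hj hu
  have h2 : t2V W (boolPair ⟬LabelCoverInstance.encoding.encode φ, R, p⟭ (ones e)) =
      [decide (K.fst = p / W) && !(e % 2 ^ W).testBit (K.projAt (p % W))] := andFn_apply hi (notFn_apply hh)
  rw [testV, orFn_apply h1 h2]
  rfl

/-! ### The pieces of the element folds -/

/-- **The element piece**: the frame `⟨⌜e⌝, ε⟩` of `⌜e⌝` if `e ∈ S_{i,u}`, nothing otherwise.
[cite: AroraBarak2009, proof of Thm. 22.31 (§22.8)] -/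
noncomputable def pieceE (W : ℕ) : List Bool → List Bool :=
  iteFn (testV W) (fanoutFn (lenBinF ∘ sndF) (fun _ => [])) (fun _ => [])

/-- **The header piece**: a `1` if `e ∈ S_{i,u}`, nothing otherwise (concatenating to `1^{|S_{i,u}|}`).
[cite: AroraBarak2009, proof of Thm. 22.31 (§22.8)] -/
noncomputable def hpieceE (W : ℕ) : List Bool → List Bool :=
  iteFn (testV W) (fun _ => [true]) (fun _ => [])

/-- `pieceE W ∈ FP`. [folklore] -/
theorem pieceE_mem_FP (W : ℕ) : pieceE W ∈ FP :=
  iteFn_mem_FP (testV_mem_FP W) (fanoutFn_mem_FP (comp_mem_FP lenBinF_mem_FP sndF_mem_FP) (const_mem_FP _))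
    (const_mem_FP _)

/-- `hpieceE W ∈ FP`. [folklore] -/
theorem hpieceE_mem_FP (W : ℕ) : hpieceE W ∈ FP :=
  iteFn_mem_FP (testV_mem_FP W) (const_mem_FP _) (const_mem_FP _)

/-- Value of the element piece. [folklore] -/
theorem pieceE_apply {W : ℕ} (hW : 0 < W) (φ : LabelCoverInstance) (R : List Bool) (p : ℕ) {e : ℕ}
    (hr : e / 2 ^ W < φ.numConstraints) :
    pieceE W (boolPair ⟬LabelCoverInstance.encoding.encode φ, R, p⟭ (ones e)) =
      if (φ.constraints[e / 2 ^ W]'hr).lyRow (p / W) (p % W) (e % 2 ^ W) then boolPair (encodeNat e) []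
      else [] := by
  rw [pieceE, iteFn_apply (testV_eq hW φ R p hr)]
  simp

/-- Value of the header piece. [folklore] -/
theorem hpieceE_apply {W : ℕ} (hW : 0 < W) (φ : LabelCoverInstance) (R : List Bool) (p : ℕ) {e : ℕ}
    (hr : e / 2 ^ W < φ.numConstraints) :
    hpieceE W (boolPair ⟬LabelCoverInstance.encoding.encode φ, R, p⟭ (ones e)) =
      if (φ.constraints[e / 2 ^ W]'hr).lyRow (p / W) (p % W) (e % 2 ^ W) then [true] else [] := by
  rw [hpieceE, iteFn_apply (testV_eq hW φ R p hr)]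

/-- The header piece is at most one symbol, on every input. [folklore] -/
theorem length_hpieceE_le (W : ℕ) (z : List Bool) : (hpieceE W z).length ≤ 1 := by
  obtain ⟨b, hb⟩ := oneBit_testV W z
  rw [hpieceE, iteFn_apply hb]
  cases b <;> simp

/-- A quotient bound: `e < m 2^W → e / 2^W < m`. [folklore] -/
theorem div_lt_of_lt_mul {W m e : ℕ} (he : e < m * 2 ^ W) : e / 2 ^ W < m :=
  (Nat.div_lt_iff_lt_mul (Nat.two_pow_pos W)).2 he

/-- **Membership in `S_{i,u}` through the rows**: for `e < m 2^W` and alphabet size `W`,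
`lyMem φ i u e = lyRow φ_{e / 2^W} i u (e % 2^W)`. [cite: AroraBarak2009, proof of Thm. 22.31 (§22.8)] -/
theorem lyMem_eq {W : ℕ} {φ : LabelCoverInstance} (hW : φ.alphabetSize = W) (i u : ℕ) {e : ℕ}
    (he : e < φ.numConstraints * 2 ^ W) :
    φ.lyMem i u e = (φ.constraints[e / 2 ^ W]'(div_lt_of_lt_mul he)).lyRow i u (e % 2 ^ W) := by
  have h := φ.lyMem_block (div_lt_of_lt_mul he) (hW ▸ Nat.mod_lt e (Nat.two_pow_pos W)) i u
  rwa [hW, Nat.div_add_mod] at h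

/-! ### The element folds: the code of one set `S_{i,u}` -/

/-- The countdown `⌜m · 2^W⌝` of the element folds (the size of the ground set), from `1ᵐ`.
[cite: AroraBarak2009, proof of Thm. 22.31 (§22.8, "The ground set is `[m] × B`")] -/
noncomputable def cntE (W : ℕ) : List Bool → List Bool :=
  prodFn ∘ fanoutFn (lenBinF ∘ nthF 2 ∘ fstF ∘ fstF) (fun _ => encodeNat (2 ^ W))

/-- Value of `cntE`. [folklore] -/
theorem cntE_apply (W : ℕ) (φ : LabelCoverInstance) (R : List Bool) (p : ℕ) :
    cntE W ⟬LabelCoverInstance.encoding.encode φ, R, p⟭ = encodeNat (φ.numConstraints * 2 ^ W) := by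
  simp [cntE]

/-- `cntE W ∈ FP`. [folklore] -/
theorem cntE_mem_FP (W : ℕ) : cntE W ∈ FP :=
  comp_mem_FP prodFn_mem_FP (fanoutFn_mem_FP
    (comp_mem_FP lenBinF_mem_FP (comp_mem_FP (nthF_mem_FP 2) (comp_mem_FP fstF_mem_FP fstF_mem_FP)))
    (const_mem_FP _))

/-- The initial record `⟨z, ⟨⌜m 2^W⌝, ⟨1⁰, ε⟩⟩⟩` of the element folds. [folklore] -/
noncomputable def initE (W : ℕ) : List Bool → List Bool :=
  fanoutFn id (fanoutFn (cntE W) (fun _ => boolPair [] []))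

/-- Value of `initE`. [folklore] -/
theorem initE_apply (W : ℕ) (φ : LabelCoverInstance) (R : List Bool) (p : ℕ) :
    initE W ⟬LabelCoverInstance.encoding.encode φ, R, p⟭ =
      boolPair ⟬LabelCoverInstance.encoding.encode φ, R, p⟭
        (boolPair (encodeNat (φ.numConstraints * 2 ^ W)) (boolPair (ones 0) [])) := by
  rw [initE, fanoutFn_apply, fanoutFn_apply, cntE_apply]
  rfl

/-- `initE W ∈ FP`. [folklore] -/
theorem initE_mem_FP (W : ℕ) : initE W ∈ FP :=
  fanoutFn_mem_FP id_mem_FP (fanoutFn_mem_FP (cntE_mem_FP W) (const_mem_FP _))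

/-- **The element fold of a piece function**: `2^W |z|` rounds available, `m 2^W` used; the result is
the concatenation of the pieces over the element index (`runE_apply`).
[cite: AroraBarak2009, §1.3 (bounded loops)] -/
noncomputable def runE (W C : ℕ) (f : List Bool → List Bool) : List Bool → List Bool :=
  sndPow 2 ∘ foldLoop appF (clipF C f) (Polynomial.C (2 ^ W) * Polynomial.X) ∘ initE W

/-- `runE W C f ∈ FP` for `f ∈ FP` (unconditionally: the pieces are clipped).
[cite: AroraBarak2009, §1.3 (bounded loops)] -/
theorem runE_mem_FP (W C : ℕ) {f : List Bool → List Bool} (hf : f ∈ FP) : runE W C f ∈ FP :=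
  comp_mem_FP (sndPow_mem_FP 2)
    (comp_mem_FP (foldLoop_clipF_mem_FP C appF_mem_FP length_appF_le hf _) (initE_mem_FP W))

/-- The set-piece argument is at least as long as the instance code. [folklore] -/
theorem length_le_length_arg (w R : List Bool) (p : ℕ) : w.length ≤ (⟬w, R, p⟭).length := by
  simp only [length_boolPair]; omega

/-- **Value of the element fold**: the concatenation of the pieces `f ⟨z, 1ᵉ⟩`, `e < m 2^W`, provided
these are within the clipping bound. [folklore] -/
theorem runE_apply {W C : ℕ} {f : List Bool → List Bool} (φ : LabelCoverInstance) (R : List Bool) (p : ℕ)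
    (hC : ∀ e, e < φ.numConstraints * 2 ^ W →
      (f (boolPair ⟬LabelCoverInstance.encoding.encode φ, R, p⟭ (ones e))).length ≤
        C * ((⟬LabelCoverInstance.encoding.encode φ, R, p⟭).length + 1)) :
    runE W C f ⟬LabelCoverInstance.encoding.encode φ, R, p⟭ =
      ccat (fun e => f (boolPair ⟬LabelCoverInstance.encoding.encode φ, R, p⟭ (ones e)))
        (φ.numConstraints * 2 ^ W) := by
  have hm : φ.numConstraints * 2 ^ W ≤
      (Polynomial.C (2 ^ W) * Polynomial.X).eval (⟬LabelCoverInstance.encoding.encode φ, R, p⟭).length := by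
    rw [Polynomial.eval_mul, Polynomial.eval_C, Polynomial.eval_X, Nat.mul_comm]
    have h1 := two_mul_numConstraints_le_length_encode φ
    have h2 := length_le_length_arg (LabelCoverInstance.encoding.encode φ) R p
    exact Nat.mul_le_mul_left _ (by omega)
  rw [runE, Function.comp_apply, Function.comp_apply, initE_apply, foldLoop_apply _ _ hm,
    foldAcc_clipF (fun j _ hj => hC j (by omega)), foldAcc_appF]
  simp [sndPow]

/-- The clipping constant of the element pieces. [folklore] -/
def clipE (W : ℕ) : ℕ := 2 ^ (W + 1) + 4

/-- **The code of the set `S_{i,u}`**: unary length header by the header fold, framed members by the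
element fold. [cite: AroraBarak2009, proof of Thm. 22.31 (§22.8)] -/
noncomputable def setCodeE (W : ℕ) : List Bool → List Bool :=
  fanoutFn (runE W 1 (hpieceE W)) (runE W (clipE W) (pieceE W))

/-- `setCodeE W ∈ FP`. [folklore] -/
theorem setCodeE_mem_FP (W : ℕ) : setCodeE W ∈ FP :=
  fanoutFn_mem_FP (runE_mem_FP W 1 (hpieceE_mem_FP W)) (runE_mem_FP W (clipE W) (pieceE_mem_FP W))

/-- The set index of a used round is positive-alphabet: `p < n W → 0 < W`. [folklore] -/
theorem pos_of_lt_mul {p n W : ℕ} (hp : p < n * W) : 0 < W :=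
  Nat.pos_of_ne_zero (by rintro rfl; simp at hp)

/-- **The element pieces folded are within the clipping bound**: `|pieceE| ≤ 2 m 2^W + 4`. [folklore] -/
theorem length_pieceE_le {W : ℕ} (hW : 0 < W) (φ : LabelCoverInstance) (R : List Bool) (p : ℕ) {e : ℕ}
    (he : e < φ.numConstraints * 2 ^ W) :
    (pieceE W (boolPair ⟬LabelCoverInstance.encoding.encode φ, R, p⟭ (ones e))).length ≤
      2 * (φ.numConstraints * 2 ^ W) + 4 := by
  rw [pieceE_apply hW φ R p (div_lt_of_lt_mul he)]
  split_ifs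
  · rw [length_boolPair, List.length_nil, Nat.add_zero]
    exact two_mul_length_encodeNat_le he
  · simp

/-- The clipping bound of the element fold holds on the pieces folded. [folklore] -/
theorem length_pieceE_le_clip {W : ℕ} (hW : 0 < W) (φ : LabelCoverInstance) (R : List Bool) (p : ℕ)
    {e : ℕ} (he : e < φ.numConstraints * 2 ^ W) :
    (pieceE W (boolPair ⟬LabelCoverInstance.encoding.encode φ, R, p⟭ (ones e))).length ≤
      clipE W * ((⟬LabelCoverInstance.encoding.encode φ, R, p⟭).length + 1) := by
  refine (length_pieceE_le hW φ R p he).trans ?_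
  have h1 := two_mul_numConstraints_le_length_encode φ
  have h2 := length_le_length_arg (LabelCoverInstance.encoding.encode φ) R p
  have h3 : φ.numConstraints * 2 ^ W ≤ (⟬LabelCoverInstance.encoding.encode φ, R, p⟭).length * 2 ^ W :=
    Nat.mul_le_mul_right _ (by omega)
  rw [clipE, Nat.pow_succ]
  nlinarith [h3, Nat.zero_le ((⟬LabelCoverInstance.encoding.encode φ, R, p⟭).length * 2 ^ W)]

/-- **The header fold yields `1^{|S_{i,u}|}`** (`i = p / W`, `u = p % W`, alphabet size `W`).
[cite: AroraBarak2009, proof of Thm. 22.31 (§22.8)] -/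
theorem runE_hpieceE {W : ℕ} {φ : LabelCoverInstance} (hWa : φ.alphabetSize = W) (hW : 0 < W)
    (R : List Bool) (p : ℕ) :
    runE W 1 (hpieceE W) ⟬LabelCoverInstance.encoding.encode φ, R, p⟭ =
      ones (φ.lySet (p / W) (p % W)).length := by
  rw [runE_apply φ R p (fun e _ => (length_hpieceE_le W _).trans (by omega)), LabelCoverInstance.lySet, hWa,
    ← ccat_ite_true]
  exact ccat_congr fun e he => by rw [hpieceE_apply hW φ R p (div_lt_of_lt_mul he), lyMem_eq hWa _ _ he]

/-- **The element fold yields the framed members of `S_{i,u}`.**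
[cite: AroraBarak2009, proof of Thm. 22.31 (§22.8)] -/
theorem runE_pieceE {W : ℕ} {φ : LabelCoverInstance} (hWa : φ.alphabetSize = W) (hW : 0 < W)
    (R : List Bool) (p : ℕ) :
    runE W (clipE W) (pieceE W) ⟬LabelCoverInstance.encoding.encode φ, R, p⟭ =
      frames ((φ.lySet (p / W) (p % W)).map encodeNat) := by
  rw [runE_apply φ R p (fun e he => length_pieceE_le_clip hW φ R p he), LabelCoverInstance.lySet, hWa,
    frames_map_filter_range]
  exact ccat_congr fun e he => by rw [pieceE_apply hW φ R p (div_lt_of_lt_mul he), lyMem_eq hWa _ _ he]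

/-- **`setCodeE` computes the code of `S_{p / W, p % W}`.**
[cite: AroraBarak2009, proof of Thm. 22.31 (§22.8)] -/
theorem setCodeE_apply {W : ℕ} {φ : LabelCoverInstance} (hWa : φ.alphabetSize = W) (hW : 0 < W)
    (R : List Bool) (p : ℕ) :
    setCodeE W ⟬LabelCoverInstance.encoding.encode φ, R, p⟭ = setCode (φ.lySet (p / W) (p % W)) := by
  rw [setCodeE, fanoutFn_apply, runE_hpieceE hWa hW, runE_pieceE hWa hW, setCode]

/-! ### The set fold: the codes of all the sets -/

/-- **The set piece**: the frame `⟨code S_p, ε⟩` of the code of the `p`-th set.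
[cite: AroraBarak2009, proof of Thm. 22.31 (§22.8)] -/
noncomputable def pieceP (W : ℕ) : List Bool → List Bool :=
  fanoutFn (setCodeE W) (fun _ => [])

/-- `pieceP W ∈ FP`. [folklore] -/
theorem pieceP_mem_FP (W : ℕ) : pieceP W ∈ FP := fanoutFn_mem_FP (setCodeE_mem_FP W) (const_mem_FP _)

/-- Value of the set piece. [folklore] -/
theorem pieceP_apply {W : ℕ} {φ : LabelCoverInstance} (hWa : φ.alphabetSize = W) (hW : 0 < W)
    (R : List Bool) (p : ℕ) :
    pieceP W ⟬LabelCoverInstance.encoding.encode φ, R, p⟭ =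
      boolPair (setCode (φ.lySet (p / W) (p % W))) [] := by
  rw [pieceP, fanoutFn_apply, setCodeE_apply hWa hW]

/-- The size of a set code: `|setCode S| ≤ 2K + 2 + K (2K + 4)` for `S ⊆ [K]` listed increasingly as a
filtered range. [folklore] -/
theorem length_setCode_filter_le (P : ℕ → Bool) (K : ℕ) :
    (setCode ((List.range K).filter P)).length ≤ 2 * K + 2 + K * (2 * K + 4) := by
  rw [setCode, length_boolPair, List.length_replicate, frames_map_filter_range]
  have h1 : ((List.range K).filter P).length ≤ K := (List.length_filter_le _ _).trans (by simp)
  have h2 := length_ccat_le_of_lt (fun e => if P e then boolPair (encodeNat e) [] else []) (2 * K + 4) K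
    (fun e he => by
      show (if P e then boolPair (encodeNat e) [] else []).length ≤ 2 * K + 4
      split_ifs
      · rw [length_boolPair, List.length_nil, Nat.add_zero]; exact two_mul_length_encodeNat_le he
      · simp)
  omega

/-- The clipping constant of the set pieces. [folklore] -/
def clipP (W : ℕ) : ℕ := 4 * (2 ^ W * 2 ^ W) + 12 * 2 ^ W + 6

/-- **The set pieces folded are within the clipping bound** (the yardstick `R = 1^{(|w|+1)²}` pays for
the quadratic size of a set code). [folklore] -/
theorem length_pieceP_le_clip {W : ℕ} {φ : LabelCoverInstance} (hWa : φ.alphabetSize = W) (hW : 0 < W)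
    (p : ℕ) :
    (pieceP W ⟬LabelCoverInstance.encoding.encode φ,
        ones (((LabelCoverInstance.encoding.encode φ).length + 1) ^ 2), p⟭).length ≤
      clipP W * ((boolPair (LabelCoverInstance.encoding.encode φ)
        (ones (((LabelCoverInstance.encoding.encode φ).length + 1) ^ 2))).length + 1) := by
  set w := LabelCoverInstance.encoding.encode φ with hw
  set L := w.length with hL
  set X := (boolPair w (ones ((L + 1) ^ 2))).length with hX
  set K := φ.numConstraints * 2 ^ W with hK
  have hXe : X = 2 * L + 2 + (L + 1) ^ 2 := by rw [hX, length_boolPair, List.length_replicate]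
  have hm : 2 * φ.numConstraints ≤ L := two_mul_numConstraints_le_length_encode φ
  have hKL : K ≤ L * 2 ^ W := Nat.mul_le_mul_right _ (by omega)
  have hLX : L ≤ X := by rw [hXe]; omega
  have hLLX : L * L ≤ X := by rw [hXe]; nlinarith
  have hKK : K * K ≤ X * (2 ^ W * 2 ^ W) :=
    calc K * K ≤ (L * 2 ^ W) * (L * 2 ^ W) := Nat.mul_le_mul hKL hKL
      _ = (L * L) * (2 ^ W * 2 ^ W) := by ring
      _ ≤ X * (2 ^ W * 2 ^ W) := Nat.mul_le_mul_right _ hLLX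
  have hKX : K ≤ X * 2 ^ W := hKL.trans (Nat.mul_le_mul_right _ hLX)
  have hpc : (pieceP W ⟬w, ones ((L + 1) ^ 2), p⟭).length ≤ 2 * (2 * K + 2 + K * (2 * K + 4)) + 2 := by
    rw [hw, pieceP_apply hWa hW, length_boolPair, List.length_nil, Nat.add_zero, LabelCoverInstance.lySet, hWa,
      ← hK]
    have := length_setCode_filter_le (fun e => φ.lyMem (p / W) (p % W) e) K
    omega
  refine hpc.trans ?_
  rw [clipP]
  nlinarith [hKK, hKX, Nat.zero_le (X * (2 ^ W * 2 ^ W)), Nat.zero_le (X * 2 ^ W), Nat.zero_le X]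

/-- The yardstick record `x = ⟨w, 1^{(|w|+1)²}⟩` of the set fold. [folklore] -/
noncomputable def yardP : List Bool → List Bool :=
  fanoutFn id (polyFn ((Polynomial.X + 1) ^ 2))

/-- Value of `yardP`. [folklore] -/
theorem yardP_apply (w : List Bool) : yardP w = boolPair w (ones ((w.length + 1) ^ 2)) := by
  simp [yardP]

/-- `yardP ∈ FP`. [folklore] -/
theorem yardP_mem_FP : yardP ∈ FP := fanoutFn_mem_FP id_mem_FP (polyFn_mem_FP _)

/-- The countdown `⌜n W⌝` of the set fold (the number of sets), from `⌜n⌝`.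
[cite: AroraBarak2009, proof of Thm. 22.31 (§22.8, "The number of subsets is `nW`")] -/
noncomputable def cntP (W : ℕ) : List Bool → List Bool :=
  prodFn ∘ fanoutFn (nthF 0) (fun _ => encodeNat W)

/-- Value of `cntP`. [folklore] -/
theorem cntP_apply (W : ℕ) (φ : LabelCoverInstance) :
    cntP W (LabelCoverInstance.encoding.encode φ) = encodeNat (φ.numVars * W) := by
  simp [cntP]

/-- `cntP W ∈ FP`. [folklore] -/
theorem cntP_mem_FP (W : ℕ) : cntP W ∈ FP :=
  comp_mem_FP prodFn_mem_FP (fanoutFn_mem_FP (nthF_mem_FP 0) (const_mem_FP _))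

/-- The initial record `⟨x, ⟨⌜n W⌝, ⟨1⁰, ε⟩⟩⟩` of the set fold. [folklore] -/
noncomputable def initP (W : ℕ) : List Bool → List Bool :=
  fanoutFn yardP (fanoutFn (cntP W) (fun _ => boolPair [] []))

/-- Value of `initP`. [folklore] -/
theorem initP_apply (W : ℕ) (φ : LabelCoverInstance) :
    initP W (LabelCoverInstance.encoding.encode φ) =
      boolPair (boolPair (LabelCoverInstance.encoding.encode φ)
          (ones (((LabelCoverInstance.encoding.encode φ).length + 1) ^ 2)))
        (boolPair (encodeNat (φ.numVars * W)) (boolPair (ones 0) [])) := by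
  rw [initP, fanoutFn_apply, fanoutFn_apply, yardP_apply, cntP_apply]
  rfl

/-- `initP W ∈ FP`. [folklore] -/
theorem initP_mem_FP (W : ℕ) : initP W ∈ FP :=
  fanoutFn_mem_FP yardP_mem_FP (fanoutFn_mem_FP (cntP_mem_FP W) (const_mem_FP _))

/-- **The set fold of a piece function**: `W |x|` rounds available, `n W` used on the guarded inputs
(`n ≤ 2m ≤ |w|`); the result is the concatenation of the pieces over the set index (`runP_apply`).
[cite: AroraBarak2009, §1.3 (bounded loops)] -/
noncomputable def runP (W C : ℕ) (f : List Bool → List Bool) : List Bool → List Bool :=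
  sndPow 2 ∘ foldLoop appF (clipF C f) (Polynomial.C W * Polynomial.X) ∘ initP W

/-- `runP W C f ∈ FP` for `f ∈ FP`. [cite: AroraBarak2009, §1.3 (bounded loops)] -/
theorem runP_mem_FP (W C : ℕ) {f : List Bool → List Bool} (hf : f ∈ FP) : runP W C f ∈ FP :=
  comp_mem_FP (sndPow_mem_FP 2)
    (comp_mem_FP (foldLoop_clipF_mem_FP C appF_mem_FP length_appF_le hf _) (initP_mem_FP W))

/-- **Value of the set fold** on an instance code with `n ≤ 2m`: the concatenation of the pieces
`f ⟨x, 1ᵖ⟩`, `p < n W`, provided these are within the clipping bound. [folklore] -/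
theorem runP_apply {W C : ℕ} {f : List Bool → List Bool} (φ : LabelCoverInstance)
    (hn : φ.numVars ≤ 2 * φ.numConstraints)
    (hC : ∀ p, p < φ.numVars * W →
      (f (boolPair (boolPair (LabelCoverInstance.encoding.encode φ)
          (ones (((LabelCoverInstance.encoding.encode φ).length + 1) ^ 2))) (ones p))).length ≤
        C * ((boolPair (LabelCoverInstance.encoding.encode φ)
          (ones (((LabelCoverInstance.encoding.encode φ).length + 1) ^ 2))).length + 1)) :
    runP W C f (LabelCoverInstance.encoding.encode φ) =
      ccat (fun p => f (boolPair (boolPair (LabelCoverInstance.encoding.encode φ)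
          (ones (((LabelCoverInstance.encoding.encode φ).length + 1) ^ 2))) (ones p)))
        (φ.numVars * W) := by
  have hk : φ.numVars * W ≤ (Polynomial.C W * Polynomial.X).eval
      (boolPair (LabelCoverInstance.encoding.encode φ)
        (ones (((LabelCoverInstance.encoding.encode φ).length + 1) ^ 2))).length := by
    rw [Polynomial.eval_mul, Polynomial.eval_C, Polynomial.eval_X, Nat.mul_comm, length_boolPair]
    have h1 := two_mul_numConstraints_le_length_encode φ
    exact Nat.mul_le_mul_left _ (by omega)
  rw [runP, Function.comp_apply, Function.comp_apply, initP_apply, foldLoop_apply _ _ hk,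
    foldAcc_clipF (fun j _ hj => hC j (by omega)), foldAcc_appF]
  simp [sndPow]

/-- **The set fold yields the framed codes of all the sets `S_{i,u}`** (alphabet size `W`, `n ≤ 2m`).
[cite: AroraBarak2009, proof of Thm. 22.31 (§22.8)] -/
theorem runP_pieceP {W : ℕ} {φ : LabelCoverInstance} (hWa : φ.alphabetSize = W)
    (hn : φ.numVars ≤ 2 * φ.numConstraints) :
    runP W (clipP W) (pieceP W) (LabelCoverInstance.encoding.encode φ) =
      frames (φ.lyReduce.sets.map setCode) := by
  rw [runP_apply φ hn (fun p hp => length_pieceP_le_clip hWa (pos_of_lt_mul hp) p)]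
  simp only [LabelCoverInstance.lyReduce, List.map_map, hWa]
  rw [frames_map_range]
  exact ccat_congr fun p hp => by rw [pieceP_apply hWa (pos_of_lt_mul hp)]; rfl

/-! ### The main branch, the guard, the whole map -/

/-- The unary length header `1^{n W}` of the list of sets: `⌜n⌝` in unary (capped by `|w| ≥ 2m ≥ n` on
the guarded inputs), `W` symbols per symbol.
[cite: AroraBarak2009, proof of Thm. 22.31 (§22.8, "The number of subsets is `nW`")] -/
noncomputable def hdrP (W : ℕ) : List Bool → List Bool :=
  onesMulFn W ∘ binToUnaryFn ∘ fanoutFn id (nthF 0)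

/-- `hdrP W ∈ FP`. [folklore] -/
theorem hdrP_mem_FP (W : ℕ) : hdrP W ∈ FP :=
  comp_mem_FP (onesMulFn_mem_FP W) (comp_mem_FP binToUnaryFn_mem_FP (fanoutFn_mem_FP id_mem_FP (nthF_mem_FP 0)))

/-- Value of `hdrP` on an instance code with `n ≤ 2m`. [folklore] -/
theorem hdrP_apply (W : ℕ) {φ : LabelCoverInstance} (hn : φ.numVars ≤ 2 * φ.numConstraints) :
    hdrP W (LabelCoverInstance.encoding.encode φ) = ones (φ.numVars * W) := by
  have h1 := two_mul_numConstraints_le_length_encode φ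
  simp only [hdrP, Function.comp_apply, fanoutFn_apply, id, nthF_zero_encode, binToUnaryFn_boolPair,
    bitsToNat_encodeNat, min_eq_left (hn.trans h1), onesMulFn, List.length_replicate, Nat.mul_comm]

/-- The size `⌜m 2^W⌝` of the ground set `[m] × B`.
[cite: AroraBarak2009, proof of Thm. 22.31 (§22.8, "The ground set is `[m] × B`")] -/
noncomputable def univP (W : ℕ) : List Bool → List Bool :=
  prodFn ∘ fanoutFn (lenBinF ∘ nthF 2) (fun _ => encodeNat (2 ^ W))

/-- `univP W ∈ FP`. [folklore] -/
theorem univP_mem_FP (W : ℕ) : univP W ∈ FP :=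
  comp_mem_FP prodFn_mem_FP (fanoutFn_mem_FP (comp_mem_FP lenBinF_mem_FP (nthF_mem_FP 2)) (const_mem_FP _))

/-- Value of `univP`. [folklore] -/
theorem univP_apply (W : ℕ) (φ : LabelCoverInstance) :
    univP W (LabelCoverInstance.encoding.encode φ) = encodeNat (φ.numConstraints * 2 ^ W) := by
  simp [univP]

/-- **The main branch**: `⟨⌜m 2^W⌝, ⟨⟨1^{nW}, frames [code S_p]_p⟩, ⌜n⌝⟩⟩`, the code of `lyReduce φ`.
[cite: AroraBarak2009, proof of Thm. 22.31 (§22.8)] -/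
noncomputable def mainP (W : ℕ) : List Bool → List Bool :=
  fanoutFn (univP W) (fanoutFn (fanoutFn (hdrP W) (runP W (clipP W) (pieceP W))) (nthF 0))

/-- `mainP W ∈ FP`. [folklore] -/
theorem mainP_mem_FP (W : ℕ) : mainP W ∈ FP :=
  fanoutFn_mem_FP (univP_mem_FP W) (fanoutFn_mem_FP
    (fanoutFn_mem_FP (hdrP_mem_FP W) (runP_mem_FP W (clipP W) (pieceP_mem_FP W))) (nthF_mem_FP 0))

/-- **The main branch computes the code of `lyReduce φ`** on instance codes over the alphabet `[W]`
with `n ≤ 2m`. [cite: AroraBarak2009, proof of Thm. 22.31 (§22.8)] -/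
theorem mainP_apply {W : ℕ} {φ : LabelCoverInstance} (hWa : φ.alphabetSize = W)
    (hn : φ.numVars ≤ 2 * φ.numConstraints) :
    mainP W (LabelCoverInstance.encoding.encode φ) = SetCoverInstance.encoding.encode φ.lyReduce := by
  rw [encode_setCover, mainP, fanoutFn_apply, fanoutFn_apply, fanoutFn_apply, univP_apply, hdrP_apply W hn,
    runP_pieceP hWa hn, nthF_zero_encode, LabelCoverInstance.lyReduce_univSize,
    LabelCoverInstance.length_lyReduce_sets, LabelCoverInstance.lyReduce_K, hWa]

/-- **The guard** `[W' = W] ∧ ¬[2m < n]`: the alphabet field equals `⌜W⌝` in value and `n ≤ 2m`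
(`m` read off the unary header in binary, doubled by a leading `0`).
[cite: AroraBarak2009, proof of Thm. 22.31 (§22.8)] -/
noncomputable def guardP (W : ℕ) : List Bool → List Bool :=
  andFn (eqValFn ∘ fanoutFn (nthF 1) (fun _ => encodeNat W))
    (notFn (ltFn ∘ fanoutFn (List.cons false ∘ lenBinF ∘ nthF 2) (nthF 0)))

/-- `guardP W ∈ FP`. [folklore] -/
theorem guardP_mem_FP (W : ℕ) : guardP W ∈ FP :=
  andFn_mem_FP (comp_mem_FP eqValFn_mem_FP (fanoutFn_mem_FP (nthF_mem_FP 1) (const_mem_FP _)))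
    (notFn_mem_FP (comp_mem_FP ltFn_mem_FP (fanoutFn_mem_FP
      (comp_mem_FP (cons_mem_FP false) (comp_mem_FP lenBinF_mem_FP (nthF_mem_FP 2))) (nthF_mem_FP 0))))

/-- **Value of the guard on an instance code.** [folklore] -/
theorem guardP_apply (W : ℕ) (φ : LabelCoverInstance) :
    guardP W (LabelCoverInstance.encoding.encode φ) =
      [decide (φ.alphabetSize = W) && !decide (2 * φ.numConstraints < φ.numVars)] := by
  refine andFn_apply ?_ (notFn_apply ?_)
  · simp only [Function.comp_apply, fanoutFn_apply, nthF_one_encode, eqValFn_boolPair, bitsToNat_encodeNat]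
  · simp only [Function.comp_apply, fanoutFn_apply, nthF_two_encode, nthF_zero_encode, lenBinF_apply,
      List.length_replicate, ltFn_boolPair, bitsToNat_cons, bitsToNat_encodeNat, Bool.toNat_false, Nat.zero_add]

/-- The code of the fixed instance `⟨0, [], 0⟩` off the promise. [folklore] -/
def nilCode : List Bool := SetCoverInstance.encoding.encode ⟨0, [], 0⟩

/-- **The Lund–Yannakakis map on codes**: the main branch under the guard, the code of `⟨0, [], 0⟩`
otherwise. [cite: AroraBarak2009, Thm. 22.31 (§22.8, p. 486: "polynomial-time transformation")] -/
noncomputable def lyF (W : ℕ) : List Bool → List Bool :=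
  iteFn (guardP W) (mainP W) (fun _ => nilCode)

/-- **`lyF W ∈ FP`.**
[cite: AroraBarak2009, Thm. 22.31 (§22.8, p. 486: "polynomial-time transformation"), §1.3] -/
theorem lyF_mem_FP (W : ℕ) : lyF W ∈ FP :=
  iteFn_mem_FP (guardP_mem_FP W) (mainP_mem_FP W) (const_mem_FP _)

/-- **`lyF W` computes `lyMap W` on codes**: `lyF W (code φ) = code (lyMap W φ)` for every label cover
instance `φ`. [cite: AroraBarak2009, Thm. 22.31 (§22.8)] -/
theorem lyF_encode (W : ℕ) (φ : LabelCoverInstance) :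
    lyF W (LabelCoverInstance.encoding.encode φ) =
      SetCoverInstance.encoding.encode (LabelCoverInstance.lyMap W φ) := by
  rw [lyF, iteFn_apply (guardP_apply W φ), LabelCoverInstance.lyMap]
  by_cases h : φ.alphabetSize = W ∧ φ.numVars ≤ 2 * φ.numConstraints
  · rw [if_pos h, ← mainP_apply h.1 h.2]
    simp [h.1, not_lt.2 h.2]
  · rw [if_neg h]
    have hb : (decide (φ.alphabetSize = W) && !decide (2 * φ.numConstraints < φ.numVars)) = false := by
      simpa [not_lt] using h
    rw [hb]
    rfl

end LYFP

/-- **`lyMap_mem_FP` discharged: the (patched) Lund–Yannakakis instance map is polynomial time**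
("there is a polynomial-time transformation `f` from `2CSP_W` instances to instances of SET-COVER"):
for every `W` the brick assembly `LYFP.lyF W ∈ FP` satisfies `lyF W (code φ) = code (lyMap W φ)` for
every label cover instance `φ`. [cite: AroraBarak2009, Thm. 22.31 (§22.8, p. 486)] -/
theorem lyMap_mem_FP_holds : lyMap_mem_FP := fun W =>
  ⟨LYFP.lyF W, LYFP.lyF_mem_FP W, LYFP.lyF_encode W⟩

end Literature.Computability.Complexity
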